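import Summits.MatrixMultiplication.MatrixMultiplication.Theorems.ObstructionDescentTorusLaws

/-!
# Counting equations: `I(σ_m)` has non-zero forms of polynomial degree — the degree axis `E` is contentful
(decomp-mm · lens 3 · gen 18 kernel; route-independent module: imports no `Theses` file)

Route `route-MatrixMultiplication-ObstructionDescent` (`ω(ℂ) = 2`), degree axis `E = NoPolyDegreeObstruction`
(item `stmt-MatrixMultiplication-30889`), read on the corner format by `ObstructionDescentCornerEquations.noPolyDegreeObstruction_iff_corner`:
«no equation of `σ_m((ℂ^{n×n})^{⊗3})` of degree `≤ m^c` is non-zero at `⟨n,n,n⟩`» (its equation set `rankVanishing n m` is, by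
`rankVanishing_eq_RV` (rfl), the set `RV (Fin n × Fin n) (Fin n × Fin n) (Fin n × Fin n) m` used below).  Rung R1
(`ObstructionDescentTorusLaws.eq_zero_of_totalDegree_le`, landed): the range `degree ≤ m` is EMPTY.  This module proves the
complementary UPPER bound on the initial degree of `I(σ_m)` — Kumar–Volk's dimension count (a non-zero equation of degree
`≤ N⁴` for tensors in `[N]^{⊗3}` of rank `≤ N²/300`) in the tree's language, for every format:
* §1 a polynomial killed by the substitution `x_{abc} ↦ Σ_ρ w_{ρa} u_{ρb} v_{ρc}` (BCS §20.1 `S_r = im σ_r`; tree decl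
  `secantParametrisation`) vanishes on every tensor of rank `≤ r`; the substitution at most triples degrees;
* §2 **counting**: `(3D+1)^{r(|α|+|β|+|γ|)} < C(|α||β||γ|, D)` ⟹ `RV α β γ r` contains a NON-ZERO form, homogeneous of degree `D`
  (square-free monomials of degree `D` span `C(|α||β||γ|, D)` dimensions and are mapped linearly into the polynomials of
  degree `≤ 3D` in `r(|α|+|β|+|γ|)` variables, of dimension `≤ (3D+1)^{r(|α|+|β|+|γ|)}`; a dimension drop forces a kernel vector);
* §3 at powers of two (`2^D ≤ C(2D, D)`): `(k+2)·r(|α|+|β|+|γ|) < 2^k ∧ 2·2^k ≤ |α||β||γ|` ⟹ a non-zero equation of `σ_r` of degree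
  exactly `2^k`; with R1 the initial degree of `I(σ_r)` lies in the window `(r, 2^k]` (`degree_window`);
* §4 corner cells: `rows_contentful` — for `n ≥ 2¹³` EVERY cell `n² ≤ m ≤ n³` (so every cell below `R(⟨n,n,n⟩) ≤ n³`) has a
  non-zero equation of `σ_m((ℂ^{n×n})^{⊗3})` of degree in `(m, m³]`: the rows `c ≥ 3` of `E_corner` quantify over NON-EMPTY
  equation sets — what `E` asserts there (vanishing AT `⟨n,n,n⟩`) is a property of the point, not emptiness of the ideal.

No proposition is defined; sorry-free; standard axioms.  Nothing here proves `ω = 2`.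
[cite: KumarVolk2022, Lemma 9 + Theorem 10 (arXiv:2003.12938 p. 7); BurgisserClausenShokrollahi1997, §20.1;
LandsbergGCT2017, Prop. 8.3.4.2 (p. 227)]
-/

set_option linter.dupNamespace false
set_option autoImplicit false

noncomputable section

open scoped BigOperators
open Finset

namespace Summit.MatrixMultiplication.MatrixMultiplication.Theorems.ObstructionDescentCountingEquations

open Literature.Computability.AlgebraicComplexity (triad tensorRank uncurryTensor secantParametrisation
  aeval_secantParametrisation exists_eq_sum_triad_of_tensorRank_le)
open Summit.MatrixMultiplication.MatrixMultiplication.Theorems.ObstructionDescentTorusLaws (RV mem_RV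
  eq_zero_of_totalDegree_le)

/-! ## §1 The secant substitution: vanishing and degree -/

section Substitution

variable {α β γ : Type} [Fintype α] [Fintype β] [Fintype γ] [DecidableEq α] [DecidableEq β] [DecidableEq γ]

/-- **A polynomial killed by the secant substitution is an equation of `σ_r`**: if `f(Σ_ρ w_ρ ⊗ u_ρ ⊗ v_ρ) ≡ 0` identically
in the parameters then `f` vanishes at every tensor of rank `≤ r` (each is a sum of `r` triads, `exists_eq_sum_triad_of_tensorRank_le`).
[cite: BurgisserClausenShokrollahi1997, §20.1 (S_r = im σ_r); KumarVolk2022, Lemma 9 (arXiv p. 7)] -/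
theorem aeval_eq_zero_of_bind₁_secant_eq_zero {r : ℕ} {f : MvPolynomial (α × β × γ) ℂ}
    (hf : MvPolynomial.bind₁ (secantParametrisation α β γ r) f = 0) : f ∈ RV α β γ r := by
  refine mem_RV.2 fun t ht => ?_
  obtain ⟨w, u, v, htuv⟩ := exists_eq_sum_triad_of_tensorRank_le ht
  let y : (Fin r × α) ⊕ ((Fin r × β) ⊕ (Fin r × γ)) → ℂ :=
    Sum.elim (fun p => w p.1 p.2) (Sum.elim (fun p => u p.1 p.2) (fun p => v p.1 p.2))
  have hfun : (fun x : α × β × γ => MvPolynomial.aeval y (secantParametrisation α β γ r x)) =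
      fun p : α × β × γ => t p.1 p.2.1 p.2.2 := by
    funext x
    rw [aeval_secantParametrisation, htuv]
    rfl
  have key : MvPolynomial.aeval y (MvPolynomial.bind₁ (secantParametrisation α β γ r) f) =
      MvPolynomial.aeval (fun p : α × β × γ => t p.1 p.2.1 p.2.2) f := by
    rw [MvPolynomial.aeval_bind₁, hfun]
  rw [hf, map_zero] at key
  exact key.symm

/-- Total degree grows at most by the factor `c` under substitution of each variable by a polynomial of degree
`≤ c`. [bookkeeping] -/
theorem totalDegree_bind₁_le_mul {σ τ : Type*} (φ : σ → MvPolynomial τ ℂ) (c : ℕ)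
    (hφ : ∀ i, (φ i).totalDegree ≤ c) (f : MvPolynomial σ ℂ) :
    (MvPolynomial.bind₁ φ f).totalDegree ≤ c * f.totalDegree := by
  classical
  conv_lhs => rw [f.as_sum]
  rw [map_sum]
  refine (MvPolynomial.totalDegree_finsetSum _ _).trans (Finset.sup_le fun d hd => ?_)
  rw [MvPolynomial.bind₁_monomial]
  refine (MvPolynomial.totalDegree_mul _ _).trans ?_
  rw [MvPolynomial.totalDegree_C, zero_add]
  refine (MvPolynomial.totalDegree_finsetProd _ _).trans ?_
  calc ∑ i ∈ d.support, (φ i ^ d i).totalDegree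
      ≤ ∑ i ∈ d.support, c * d i := Finset.sum_le_sum fun i _ =>
          (MvPolynomial.totalDegree_pow _ _).trans
            ((Nat.mul_le_mul_left (d i) (hφ i)).trans (le_of_eq (mul_comm _ _)))
    _ = c * d.sum (fun _ e => e) := by rw [Finsupp.sum, Finset.mul_sum]
    _ ≤ c * f.totalDegree := Nat.mul_le_mul_left c (MvPolynomial.le_totalDegree hd)

omit [Fintype α] [Fintype β] [Fintype γ] [DecidableEq α] [DecidableEq β] [DecidableEq γ] in
/-- Each coordinate of the parametrisation `σ_r` is a cubic form. [cite: KumarVolk2022, Lemma 9 (arXiv p. 7)] -/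
theorem totalDegree_secantParametrisation_le (r : ℕ) (x : α × β × γ) :
    (secantParametrisation α β γ r x).totalDegree ≤ 3 := by
  unfold secantParametrisation
  refine (MvPolynomial.totalDegree_finsetSum _ _).trans (Finset.sup_le fun ρ _ => ?_)
  refine (MvPolynomial.totalDegree_mul _ _).trans ?_
  refine (Nat.add_le_add (MvPolynomial.totalDegree_mul _ _) le_rfl).trans ?_
  have h1 : ∀ i : (Fin r × α) ⊕ ((Fin r × β) ⊕ (Fin r × γ)),
      (MvPolynomial.X i : MvPolynomial _ ℂ).totalDegree ≤ 1 := fun i => (MvPolynomial.totalDegree_X (R := ℂ) i).le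
  linarith [h1 (Sum.inl (ρ, x.1)), h1 (Sum.inr (Sum.inl (ρ, x.2.1))), h1 (Sum.inr (Sum.inr (ρ, x.2.2)))]

omit [Fintype α] [Fintype β] [Fintype γ] [DecidableEq α] [DecidableEq β] [DecidableEq γ] in
/-- The secant substitution at most triples total degrees. [cite: KumarVolk2022, proof of Theorem 10 (arXiv p. 7)] -/
theorem totalDegree_bind₁_secant_le (r : ℕ) (f : MvPolynomial (α × β × γ) ℂ) :
    (MvPolynomial.bind₁ (secantParametrisation α β γ r) f).totalDegree ≤ 3 * f.totalDegree :=
  totalDegree_bind₁_le_mul _ 3 (totalDegree_secantParametrisation_le r) f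

end Substitution

/-! ## §2 Counting equations: a dimension drop forces a kernel vector -/

section Counting

variable {α β γ : Type} [Fintype α] [Fintype β] [Fintype γ] [DecidableEq α] [DecidableEq β] [DecidableEq γ]

/-- The exponent vector `∑_{x ∈ s} e_x` of the square-free monomial `∏_{x ∈ s} x` is the indicator of `s`. [bookkeeping] -/
theorem sqExp_apply {σ : Type*} [DecidableEq σ] (s : Finset σ) (x : σ) :
    (∑ y ∈ s, Finsupp.single y 1 : σ →₀ ℕ) x = if x ∈ s then 1 else 0 := by
  rw [Finsupp.finsetSum_apply]
  simp_rw [Finsupp.single_apply]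
  rw [Finset.sum_ite_eq']

/-- Distinct subsets give distinct square-free exponents. [bookkeeping] -/
theorem sqExp_injective {σ : Type*} :
    Function.Injective (fun s : Finset σ => (∑ y ∈ s, Finsupp.single y 1 : σ →₀ ℕ)) := by
  classical
  intro s t h
  ext x
  have hx := congrArg (fun e => e x) h
  simp only [sqExp_apply] at hx
  by_cases hs : x ∈ s <;> by_cases ht : x ∈ t <;> simp [hs, ht] at hx ⊢

/-- The square-free monomial on `s` has degree `|s|`. [bookkeeping] -/
theorem degree_sqExp {σ : Type*} (s : Finset σ) : (∑ y ∈ s, Finsupp.single y 1 : σ →₀ ℕ).degree = s.card := by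
  rw [map_sum]
  simp [Finsupp.degree_single]

/-- The polynomials of total degree `≤ e` in a finite alphabet `τ` form a space of dimension `≤ (e+1)^{|τ|}`
(exponent vectors inject into the functions `τ → {0,…,e}`). [bookkeeping] -/
theorem finrank_restrictTotalDegree_le (τ : Type) [Fintype τ] (e : ℕ) :
    Module.Finite ℂ (MvPolynomial.restrictTotalDegree τ ℂ e) ∧
      Module.finrank ℂ (MvPolynomial.restrictTotalDegree τ ℂ e) ≤ (e + 1) ^ Fintype.card τ := by
  classical
  let S : Set (τ →₀ ℕ) := {n | (n.sum fun _ k => k) ≤ e}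
  let ι : S → (τ → Fin (e + 1)) := fun n i => ⟨(n : τ →₀ ℕ) i, by
    have h1 : (n : τ →₀ ℕ) i ≤ (n : τ →₀ ℕ).degree := Finsupp.le_degree i _
    have h2 : (n : τ →₀ ℕ).degree ≤ e := n.2
    omega⟩
  have hι : Function.Injective ι := fun n n' h =>
    Subtype.ext (Finsupp.ext fun i => by simpa [ι] using congrArg (fun g => (g i : ℕ)) h)
  haveI : Finite S := Finite.of_injective ι hι
  let b := MvPolynomial.basisRestrictSupport ℂ S
  refine ⟨Module.Finite.of_basis b, ?_⟩
  have hrank : Module.finrank ℂ (MvPolynomial.restrictTotalDegree τ ℂ e) = Nat.card S :=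
    Module.finrank_eq_nat_card_basis b
  rw [hrank]
  calc Nat.card S ≤ Nat.card (τ → Fin (e + 1)) := Nat.card_le_card_of_injective ι hι
    _ = (e + 1) ^ Fintype.card τ := by
        rw [Nat.card_fun]; simp [Nat.card_eq_fintype_card, Fintype.card_fin]

/-- **Counting equations** (Kumar–Volk's dimension argument, every format): if
`(3D+1)^{r(|α|+|β|+|γ|)} < C(|α||β||γ|, D)` then some NON-ZERO form of degree `D` vanishes on every tensor of rank `≤ r`
in `ℂ^α ⊗ ℂ^β ⊗ ℂ^γ`. [cite: KumarVolk2022, Theorem 10 (arXiv:2003.12938 p. 7)] -/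
theorem exists_mem_RV_ne_zero_of_choose_lt (r D : ℕ)
    (h : (3 * D + 1) ^ Fintype.card ((Fin r × α) ⊕ ((Fin r × β) ⊕ (Fin r × γ))) < (Fintype.card (α × β × γ)).choose D) :
    ∃ f ∈ RV α β γ r, f ≠ 0 ∧ f.IsHomogeneous D := by
  classical
  let I : Type := ↥((Finset.univ : Finset (α × β × γ)).powersetCard D)
  let sq : Finset (α × β × γ) → (α × β × γ →₀ ℕ) := fun s => ∑ y ∈ s, Finsupp.single y 1
  let bI : I → MvPolynomial (α × β × γ) ℂ := fun s => MvPolynomial.monomial (sq (s : Finset (α × β × γ))) 1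
  have hbI : LinearIndependent ℂ bI := by
    have hcomp : bI = (MvPolynomial.basisMonomials (α × β × γ) ℂ) ∘ (fun s : I => sq (s : Finset _)) := by
      funext s; simp [bI, MvPolynomial.coe_basisMonomials]
    rw [hcomp]
    exact (MvPolynomial.basisMonomials (α × β × γ) ℂ).linearIndependent.comp _
      (fun s t hst => Subtype.ext (sqExp_injective hst))
  let V : Submodule ℂ (MvPolynomial (α × β × γ) ℂ) := Submodule.span ℂ (Set.range bI)
  have hV : Module.finrank ℂ V = (Fintype.card (α × β × γ)).choose D := by
    rw [finrank_span_eq_card hbI, Fintype.card_coe, Finset.card_powersetCard, Finset.card_univ]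
  haveI : Module.Finite ℂ V := Module.Finite.span_of_finite ℂ (Set.finite_range bI)
  let T : Submodule ℂ (MvPolynomial ((Fin r × α) ⊕ ((Fin r × β) ⊕ (Fin r × γ))) ℂ) := MvPolynomial.restrictTotalDegree ((Fin r × α) ⊕ ((Fin r × β) ⊕ (Fin r × γ))) ℂ (3 * D)
  obtain ⟨hTfin, hT⟩ := finrank_restrictTotalDegree_le ((Fin r × α) ⊕ ((Fin r × β) ⊕ (Fin r × γ))) (3 * D)
  haveI : Module.Finite ℂ T := hTfin
  let φ : MvPolynomial (α × β × γ) ℂ →ₗ[ℂ] MvPolynomial ((Fin r × α) ⊕ ((Fin r × β) ⊕ (Fin r × γ))) ℂ :=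
    (MvPolynomial.bind₁ (secantParametrisation α β γ r)).toLinearMap
  have hgen : ∀ s : I, bI s ∈ MvPolynomial.homogeneousSubmodule (α × β × γ) ℂ D := fun s =>
    (MvPolynomial.mem_homogeneousSubmodule D _).2
      (MvPolynomial.isHomogeneous_monomial _ (by rw [degree_sqExp]; exact (Finset.mem_powersetCard.1 s.2).2))
  have hVhom : V ≤ MvPolynomial.homogeneousSubmodule (α × β × γ) ℂ D :=
    Submodule.span_le.2 (by rintro _ ⟨s, rfl⟩; exact hgen s)
  have hVT : V ≤ T.comap φ := by
    refine Submodule.span_le.2 ?_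
    rintro _ ⟨s, rfl⟩
    change φ (bI s) ∈ T
    rw [MvPolynomial.mem_restrictTotalDegree]
    have hdeg : (bI s).totalDegree ≤ D := ((MvPolynomial.mem_homogeneousSubmodule D _).1 (hgen s)).totalDegree_le
    exact (totalDegree_bind₁_secant_le r (bI s)).trans (Nat.mul_le_mul_left 3 hdeg)
  let ψ : V →ₗ[ℂ] T := (φ.comp V.subtype).codRestrict T (fun v => hVT v.2)
  have hker : LinearMap.ker ψ ≠ ⊥ := by
    intro hbot
    have hsum := LinearMap.finrank_range_add_finrank_ker ψ
    rw [hbot, finrank_bot, add_zero] at hsum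
    have hrange : Module.finrank ℂ (LinearMap.range ψ) ≤ Module.finrank ℂ T := Submodule.finrank_le _
    rw [hsum, hV] at hrange
    exact absurd (lt_of_le_of_lt (hrange.trans hT) h) (lt_irrefl _)
  obtain ⟨v, hv, hv0⟩ := Submodule.exists_mem_ne_zero_of_ne_bot hker
  refine ⟨(v : MvPolynomial (α × β × γ) ℂ), ?_, fun h0 => hv0 (Subtype.ext h0), ?_⟩
  · refine aeval_eq_zero_of_bind₁_secant_eq_zero ?_
    have := congrArg (fun w : T => (w : MvPolynomial ((Fin r × α) ⊕ ((Fin r × β) ⊕ (Fin r × γ))) ℂ)) (LinearMap.mem_ker.1 hv)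
    simpa [ψ, φ] using this
  · exact (MvPolynomial.mem_homogeneousSubmodule D _).1 (hVhom v.2)

end Counting

/-! ## §3 The binomial hypothesis at powers of two; the degree window -/

section PowersOfTwo

/-- `2^n ≤ C(2n, n)` (the same folklore bound is proved independently in the Valiant tree, `…BarrierLever….CRT.two_pow_le_centralBinom`; trees do not import each other). [folklore] -/
theorem two_pow_le_centralBinom (n : ℕ) : 2 ^ n ≤ Nat.centralBinom n := by
  induction n with
  | zero => simp [Nat.centralBinom_zero]
  | succ n ih =>
    have hrec := Nat.succ_mul_centralBinom_succ n
    have hstep : (n + 1) * (2 * 2 ^ n) ≤ (n + 1) * Nat.centralBinom (n + 1) := by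
      rw [hrec]; nlinarith [Nat.mul_le_mul (show n + 1 ≤ 2 * n + 1 by omega) ih]
    simpa [pow_succ, mul_comm] using Nat.le_of_mul_le_mul_left hstep (Nat.succ_pos n)

/-- The binomial hypothesis at `D = 2^k`: it holds as soon as `(k+2)·P < 2^k` and `2·2^k ≤ K`. [bookkeeping] -/
theorem choose_hypothesis_two_pow {k P K : ℕ} (hk : (k + 2) * P < 2 ^ k) (hK : 2 * 2 ^ k ≤ K) :
    (3 * 2 ^ k + 1) ^ P < K.choose (2 ^ k) := by
  have h1 : 3 * 2 ^ k + 1 ≤ 2 ^ (k + 2) := by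
    have : 1 ≤ 2 ^ k := Nat.one_le_two_pow
    rw [pow_add]; norm_num; omega
  calc (3 * 2 ^ k + 1) ^ P ≤ (2 ^ (k + 2)) ^ P := Nat.pow_le_pow_left h1 P
    _ = 2 ^ ((k + 2) * P) := by rw [← pow_mul]
    _ < 2 ^ (2 ^ k) := Nat.pow_lt_pow_right (by norm_num) hk
    _ ≤ Nat.centralBinom (2 ^ k) := two_pow_le_centralBinom _
    _ = (2 * 2 ^ k).choose (2 ^ k) := Nat.centralBinom_eq_two_mul_choose _
    _ ≤ K.choose (2 ^ k) := Nat.choose_le_choose _ hK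

variable {α β γ : Type} [Fintype α] [Fintype β] [Fintype γ] [DecidableEq α] [DecidableEq β] [DecidableEq γ]

/-- **Counting equations at powers of two** (every format): if `(k+2)·r(|α|+|β|+|γ|) < 2^k` and `2·2^k ≤ |α||β||γ|`
then `σ_r ⊂ ℂ^α ⊗ ℂ^β ⊗ ℂ^γ` has a NON-ZERO equation, homogeneous of degree `2^k`.
[cite: KumarVolk2022, Theorem 10 (arXiv:2003.12938 p. 7)] -/
theorem exists_mem_RV_ne_zero_two_pow (r k : ℕ)
    (hk : (k + 2) * Fintype.card ((Fin r × α) ⊕ ((Fin r × β) ⊕ (Fin r × γ))) < 2 ^ k) (hK : 2 * 2 ^ k ≤ Fintype.card (α × β × γ)) :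
    ∃ f ∈ RV α β γ r, f ≠ 0 ∧ f.IsHomogeneous (2 ^ k) :=
  exists_mem_RV_ne_zero_of_choose_lt r (2 ^ k) (choose_hypothesis_two_pow hk hK)

/-- **The degree window of `I(σ_r)`** (every format): under the room hypotheses the least degree of a non-zero equation of
`σ_r` lies in `(r, 2^k]` — nothing in degree `≤ r` (rung R1, `eq_zero_of_totalDegree_le`), a non-zero form in degree `2^k`
(counting). [cite: LandsbergGCT2017, Prop. 8.3.4.2 (p. 227); KumarVolk2022, Theorem 10 (arXiv p. 7)] -/
theorem degree_window (r k : ℕ)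
    (hk : (k + 2) * Fintype.card ((Fin r × α) ⊕ ((Fin r × β) ⊕ (Fin r × γ))) < 2 ^ k) (hK : 2 * 2 ^ k ≤ Fintype.card (α × β × γ)) :
    (∀ g ∈ RV α β γ r, g ≠ 0 → r < g.totalDegree) ∧
      ∃ f ∈ RV α β γ r, f ≠ 0 ∧ f.totalDegree = 2 ^ k := by
  refine ⟨fun g hg hg0 => ?_, ?_⟩
  · by_contra hle
    exact hg0 (eq_zero_of_totalDegree_le hg (not_lt.1 hle))
  · obtain ⟨f, hf, hf0, hhom⟩ := exists_mem_RV_ne_zero_two_pow r k hk hK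
    exact ⟨f, hf, hf0, hhom.totalDegree hf0⟩

end PowersOfTwo

/-! ## §4 The corner format `(ℂ^{n×n})^{⊗3}` of the route and the cells of `E` -/

section Corner

/-- **The degree window at a corner cell**: if `(k+2)·3m·n² < 2^k` and `2·2^k ≤ n⁶`, the initial degree of
`I(σ_m((ℂ^{n×n})^{⊗3}))` lies in `(m, 2^k]` (the equation set is `rankVanishing n m` of `ObstructionDescentCornerEquations`,
by `rankVanishing_eq_RV`). [cite: KumarVolk2022, Theorem 10 (arXiv p. 7); LandsbergGCT2017, Prop. 8.3.4.2 (p. 227)] -/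
theorem corner_degree_window (n m k : ℕ)
    (hk : (k + 2) * (3 * (m * (n * n))) < 2 ^ k) (hK : 2 * 2 ^ k ≤ (n * n) * ((n * n) * (n * n))) :
    (∀ g ∈ RV (Fin n × Fin n) (Fin n × Fin n) (Fin n × Fin n) m, g ≠ 0 → m < g.totalDegree) ∧
      ∃ f ∈ RV (Fin n × Fin n) (Fin n × Fin n) (Fin n × Fin n) m, f ≠ 0 ∧ f.totalDegree = 2 ^ k := by
  refine degree_window m k ?_ ?_
  · have : Fintype.card ((Fin m × (Fin n × Fin n)) ⊕ ((Fin m × (Fin n × Fin n)) ⊕ (Fin m × (Fin n × Fin n)))) = 3 * (m * (n * n)) := by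
      simp only [Fintype.card_sum, Fintype.card_prod, Fintype.card_fin]; ring
    rwa [this]
  · have : Fintype.card ((Fin n × Fin n) × (Fin n × Fin n) × (Fin n × Fin n)) = (n * n) * ((n * n) * (n * n)) := by
      simp only [Fintype.card_prod, Fintype.card_fin]
    rwa [this]

/-- The room parameter: for `A ≠ 0` some power of two satisfies `(k+2)·A < 2^k ≤ 16·A·(log₂ A + 3)`
(`k = log₂ A + log₂(log₂ A + 3) + 4`). [bookkeeping] -/
theorem room_two_pow (A : ℕ) (hA : A ≠ 0) :
    ∃ k : ℕ, (k + 2) * A < 2 ^ k ∧ 2 ^ k ≤ 16 * (A * (Nat.log 2 A + 3)) := by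
  set L := Nat.log 2 A with hL
  set J := Nat.log 2 (L + 3) with hJ
  refine ⟨L + J + 4, ?_, ?_⟩
  · have hA2 : A < 2 ^ (L + 1) := Nat.lt_pow_succ_log_self (by norm_num) A
    have hL3 : L + 3 < 2 ^ (J + 1) := Nat.lt_pow_succ_log_self (by norm_num) (L + 3)
    have hJ2 : J < 2 ^ J := Nat.lt_two_pow_self
    have hk : L + J + 4 + 2 ≤ 2 ^ (J + 3) := by
      rw [pow_succ] at hL3
      have : 2 ^ (J + 3) = 2 ^ J * 8 := by rw [pow_add]; norm_num
      omega
    calc (L + J + 4 + 2) * A ≤ 2 ^ (J + 3) * A := Nat.mul_le_mul_right A hk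
      _ < 2 ^ (J + 3) * 2 ^ (L + 1) := (Nat.mul_lt_mul_left (by positivity)).2 hA2
      _ = 2 ^ (L + J + 4) := by rw [← pow_add]; congr 1; omega
  · have h2L : 2 ^ L ≤ A := Nat.pow_log_le_self 2 hA
    have h2J : 2 ^ J ≤ L + 3 := Nat.pow_log_le_self 2 (by omega)
    calc 2 ^ (L + J + 4) = 16 * (2 ^ L * 2 ^ J) := by
          rw [show L + J + 4 = 4 + L + J by omega, pow_add, pow_add]; ring
      _ ≤ 16 * (A * (L + 3)) := Nat.mul_le_mul_left 16 (Nat.mul_le_mul h2L h2J)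

/-- **Explicit room**: at a corner cell `(n, m)` with `32·A·(log₂ A + 3) ≤ n⁶`, `A = 3mn²`, there is a non-zero equation
of `σ_m((ℂ^{n×n})^{⊗3})` of degree in `(m, 16·A·(log₂ A + 3)]`. [cite: KumarVolk2022, Theorem 10 (arXiv p. 7)] -/
theorem exists_mem_RV_corner_ne_zero_of_room {n m : ℕ} (hm : 0 < m) (hn : 0 < n)
    (hroom : 32 * ((3 * (m * (n * n))) * (Nat.log 2 (3 * (m * (n * n))) + 3)) ≤ (n * n) * ((n * n) * (n * n))) :
    ∃ f ∈ RV (Fin n × Fin n) (Fin n × Fin n) (Fin n × Fin n) m, f ≠ 0 ∧ m < f.totalDegree ∧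
      f.totalDegree ≤ 16 * ((3 * (m * (n * n))) * (Nat.log 2 (3 * (m * (n * n))) + 3)) := by
  have hA : 3 * (m * (n * n)) ≠ 0 := by positivity
  obtain ⟨k, hk, hkle⟩ := room_two_pow _ hA
  have hK : 2 * 2 ^ k ≤ (n * n) * ((n * n) * (n * n)) := le_trans (by omega) hroom
  obtain ⟨hlow, f, hf, hf0, hdeg⟩ := corner_degree_window n m k hk hK
  exact ⟨f, hf, hf0, hlow f hf hf0, hdeg ▸ hkle⟩

/-- `96·(5ℓ + 9) ≤ 2^ℓ` from `ℓ = 13` on. [bookkeeping] -/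
theorem aux_two_pow (ℓ : ℕ) (h : 13 ≤ ℓ) : 96 * (5 * ℓ + 9) ≤ 2 ^ ℓ := by
  induction ℓ, h using Nat.le_induction with
  | base => norm_num
  | succ ℓ _ ih => rw [pow_succ]; omega

/-- The room and the degree budget at the cells `n² ≤ m ≤ n³`, `n ≥ 2¹³`. [bookkeeping] -/
theorem room_of_le_cube {n m : ℕ} (hn : 2 ^ 13 ≤ n) (hcell : n * n ≤ m) (hm : m ≤ n * n * n) :
    32 * ((3 * (m * (n * n))) * (Nat.log 2 (3 * (m * (n * n))) + 3)) ≤ (n * n) * ((n * n) * (n * n)) ∧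
      16 * ((3 * (m * (n * n))) * (Nat.log 2 (3 * (m * (n * n))) + 3)) ≤ m ^ 3 := by
  set ℓ := Nat.log 2 n with hℓdef
  have hn0 : n ≠ 0 := (lt_of_lt_of_le (by positivity) hn).ne'
  have hℓ : 13 ≤ ℓ := Nat.le_log_of_pow_le (by norm_num) hn
  have hn2 : n < 2 ^ (ℓ + 1) := Nat.lt_pow_succ_log_self (by norm_num) n
  have hm0 : m ≠ 0 := (lt_of_lt_of_le (Nat.mul_pos (Nat.pos_of_ne_zero hn0) (Nat.pos_of_ne_zero hn0)) hcell).ne'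
  have hA_lt : 3 * (m * (n * n)) < 2 ^ (5 * ℓ + 7) := by
    have h5 : n ^ 5 < (2 ^ (ℓ + 1)) ^ 5 := Nat.pow_lt_pow_left hn2 (by norm_num)
    calc 3 * (m * (n * n)) ≤ 3 * (n * n * n * (n * n)) :=
          Nat.mul_le_mul_left 3 (Nat.mul_le_mul_right _ hm)
      _ = 3 * n ^ 5 := by ring
      _ < 4 * (2 ^ (ℓ + 1)) ^ 5 := by omega
      _ = 2 ^ (5 * ℓ + 7) := by
          rw [← pow_mul, show (4 : ℕ) = 2 ^ 2 by norm_num, ← pow_add]; congr 1; ring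
  have hL : Nat.log 2 (3 * (m * (n * n))) < 5 * ℓ + 7 := Nat.log_lt_of_lt_pow (by positivity) hA_lt
  have hpow : 96 * (5 * ℓ + 9) ≤ n := (aux_two_pow ℓ hℓ).trans (Nat.pow_log_le_self 2 hn0)
  have hB : Nat.log 2 (3 * (m * (n * n))) + 3 ≤ 5 * ℓ + 9 := by omega
  have hnm : n ≤ m := le_trans (Nat.le_mul_self n) hcell
  constructor
  · calc 32 * ((3 * (m * (n * n))) * (Nat.log 2 (3 * (m * (n * n))) + 3))
        ≤ 32 * ((3 * (m * (n * n))) * (5 * ℓ + 9)) := Nat.mul_le_mul_left 32 (Nat.mul_le_mul_left _ hB)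
      _ = (m * (n * n)) * (96 * (5 * ℓ + 9)) := by ring
      _ ≤ (n * n * n * (n * n)) * n := Nat.mul_le_mul (Nat.mul_le_mul_right _ hm) hpow
      _ = (n * n) * ((n * n) * (n * n)) := by ring
  · calc 16 * ((3 * (m * (n * n))) * (Nat.log 2 (3 * (m * (n * n))) + 3))
        ≤ 16 * ((3 * (m * (n * n))) * (5 * ℓ + 9)) := Nat.mul_le_mul_left 16 (Nat.mul_le_mul_left _ hB)
      _ = (m * (n * n)) * (48 * (5 * ℓ + 9)) := by ring
      _ ≤ (m * m) * n := Nat.mul_le_mul (Nat.mul_le_mul_left m hcell) (by omega)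
      _ ≤ (m * m) * m := Nat.mul_le_mul_left _ hnm
      _ = m ^ 3 := by ring

/-- **Every cell `n² ≤ m ≤ n³` (`n ≥ 2¹³`) has a non-zero corner equation of degree in `(m, m³]`.**
[cite: KumarVolk2022, Theorem 10 (arXiv p. 7); LandsbergGCT2017, Prop. 8.3.4.2 (p. 227)] -/
theorem exists_mem_RV_corner_ne_zero_of_le_cube {n m : ℕ} (hn : 2 ^ 13 ≤ n) (hcell : n * n ≤ m)
    (hm : m ≤ n * n * n) :
    ∃ f ∈ RV (Fin n × Fin n) (Fin n × Fin n) (Fin n × Fin n) m, f ≠ 0 ∧ m < f.totalDegree ∧ f.totalDegree ≤ m ^ 3 := by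
  obtain ⟨hroom, hdeg⟩ := room_of_le_cube hn hcell hm
  have hn0 : 0 < n := lt_of_lt_of_le (by positivity) hn
  have hm0 : 0 < m := lt_of_lt_of_le (by positivity) hcell
  obtain ⟨f, hf, hf0, hlow, hle⟩ := exists_mem_RV_corner_ne_zero_of_room hm0 hn0 hroom
  exact ⟨f, hf, hf0, hlow, hle.trans hdeg⟩

/-- **The rows `c ≥ 3` of the degree axis are contentful** (quantifier shape of `E_corner`): from `n = 2¹³` on, at every cell
`n² ≤ m ≤ n³` — so at every cell below `R(⟨n,n,n⟩) ≤ n³`, the only cells where `E` can fail — `E_corner` quantifies over a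
NON-EMPTY set of non-zero equations of `σ_m` of degree `≤ m^c` (contrast rung R1: the range `≤ m` IS empty,
`ObstructionDescentFormatDegreeBlind.noPolyDegreeObstruction_row_one`). [cite: KumarVolk2022, Theorem 10 (arXiv p. 7)] -/
theorem rows_contentful (c : ℕ) (hc : 3 ≤ c) :
    ∃ n₁ : ℕ, ∀ n m : ℕ, n₁ ≤ n → n * n ≤ m → m ≤ n * n * n →
      ∃ f ∈ RV (Fin n × Fin n) (Fin n × Fin n) (Fin n × Fin n) m, f ≠ 0 ∧ m < f.totalDegree ∧ f.totalDegree ≤ m ^ c := by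
  refine ⟨2 ^ 13, fun n m hn hcell hm => ?_⟩
  obtain ⟨f, hf, hf0, hlow, hle⟩ := exists_mem_RV_corner_ne_zero_of_le_cube hn hcell hm
  have hm0 : 0 < m := lt_of_lt_of_le (lt_of_lt_of_le (by positivity) (Nat.mul_le_mul hn hn)) hcell
  exact ⟨f, hf, hf0, hlow, hle.trans (Nat.pow_le_pow_right hm0 hc)⟩

end Corner

end Summit.MatrixMultiplication.MatrixMultiplication.Theorems.ObstructionDescentCountingEquations

end
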